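import Summits.ABC.IUTFork.Cor312GenuineKLocalType
import Literature.IUT.LogVolume.SubThetaFieldRamificationFifteen
import HarnessLib

/-!
# [IUTchIII] Cor. 3.12, branch C / R-W window table — the «PARITY» LOCAL TYPE at a RATIONAL point: every fibre point `x₀ | p` of a
# genuine Θ-volume datum over `(ratPoint q, l)` at a pole `p ∉ {2,3,5,l}` of `j(q)` with `ord_p q`, `ord_p(q − 1)` EVEN has
# `¬ p ∣ e(K_{x₀}/ℚ_p)` and `e(K_{x₀}/ℚ_p) ∣ 15·l`

PROOF-ONLY support file (D-0012; 0 definitions, 0 `Prop` facts, no instance) of the abc-iut cell (R-W «WINDOW Θ-SIDE INEQUALITY», lane P−,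
seat abc-iut-w4-d087 gen 6; sequel of this seat's `Cor312GenuineKLocalTypeEven` (the HEX point `λ_k`, `k` even) for an ARBITRARY rational
point). TAKES NO SIDE on [IUTchIII] Cor. 3.12 (S. Mochizuki, *Inter-universal Teichmüller theory III*, RIMS manuscript, Cor. 3.12 p. 173–174)
or on any author: classical algebraic number theory on the cell's typed Θ-volume data.

THE POINT. abc-iut-W-neg-1's LOCAL-TYPE LEMMA `GenuineK.absRamificationIdx_kOf_dvd_ratPoint` (p459442) gives `e(K_{x₀}/ℚ_p) ∣ 60·l` at every
fibre point over a rational pole `p ∉ {2,3,5,l}` of `j(q)`, and its cyclic sharpening `∣ 30·l` (p461051/p461700). When BOTH `ord_p q` and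
`ord_p(q − 1)` are EVEN — e.g. the Frey–Legendre point `q = a/c` of an `abc`-triple at a prime `p` dividing `a`, `b` or `c` to an EVEN power —
the remaining factor `2` disappears: the Legendre curve `y² = x(x−1)(x−q)` is MULTIPLICATIVE at `p` over `ℚ` itself (Silverman *AEC*
VII.5.4 (c): Case 2 when `q ∈ ℤ_p`, `q ≡ 0, 1`; Case 3 with the rational rescaling `d = p^{−ord_p(q)/2}` when `q ∉ ℤ_p`, this seat's
`legendre_hasMultiplicativeReductionAt_of_one_lt_valuation_of_valuation_sq_eq`) and inertia at `p` fixes `√−1, √q, √(q−1)`, so this seat's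
`Cor22.ThetaVolumeDatumAt.ramificationIdx_int_dvd_fifteen_mul_ratPoint'` (p463720) applies:

* §1 `RatPointEven.valuation_natGenerator` (`|p|_v = exp(−1)`), `RatPointEven.legendre_hasMultiplicativeReductionAt_of_even` — at the place `v`
  of `ℚ` over an odd prime `p` with `ord_v j(q) < 0` and `|q|_v = exp(2m)`: the Legendre curve of `q` is multiplicative at `v` over `ℚ`;
* §2 **`Conditional.GenuineK.absRamificationIdx_kOf_dvd_fifteen_mul_ratPoint`** — `T : Cor22.ThetaVolumeDatumAt (ratPoint q) l`, a prime
  `p ∉ {2, 3, 5, l}` with `ord_p j(q) < 0`, `ord_p q` and `ord_p(q−1)` even (all three stated at the place `v` of `ℚ` with `natGenerator v = p`),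
  EVERY fibre point `x₀ | p`: **`e(K_{x₀}/ℚ_p) ∣ 15·l ∧ ¬ p ∣ e(K_{x₀}/ℚ_p)`** (hence `e ≤ 15·l`: `…_le_fifteen_mul_ratPoint`).
CONSUMERS (abc-iut rw-num-lead TARGETS.tsv, kind TE «ALL e in lℕ ≤ p−2»): the lattice-tameness input `e(K_{x₀}/ℚ_p) ≤ p − 2` of abc-iut-w5-d180's
exact tame decider / abc-iut-w5-d107's `…_of_tame_robust` becomes a THEOREM at every such datum with `15·l ≤ p − 2` (e.g. `l = 11`,
`p ∈ {179, 193}` (`v_p = 4`), `p = 251` (`v_p = 6`); `l = 13`, `p = 251`; `l = 7`, `p ∈ {179, 193, 251}`), where `60·l`, `30·l > p − 2`.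

HONEST FRAMING: bookkeeping over OUR typed objects; nothing here bears on the printed inequality of [IUTchIII] Cor. 3.12 or on the number-level
`Cor22.Cor312AtDatum`; typed ≠ proved; instantiated ≠ endorsed. [cite: Mochizuki2012, IUTchI Ex. 3.2 (iv) p. 71; IUTchIV Prop. 1.8 (vi)–(vii) p. 19, Thm. 1.10 Steps (ii)–(iii) p. 24–26]
[cite: SilvermanAEC2009, proof of Prop. VII.5.4(c), Cases 2–3] [cite: SilvermanATAEC1994, V.4–V.5 and Exercise 5.13 (b)]
[claim: Mochizuki2012, status: disputed] for every IUT quotation.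
-/

noncomputable section

open NumberField IsDedekindDomain

namespace Summit.ABC.IUTFork.Conditional

open Thm311 Thm311.Real Cor312 Cor312Prov Literature.IUT.LogVolume Literature.IUT.HodgeTheaters
  Literature.IUT.LogThetaLattice Literature.NumberTheory.NumberFields Literature.NumberTheory.DiophantineGeometry.GenEll
  Literature.NumberTheory.DiophantineGeometry Literature.NumberTheory.EllipticCurves

/-! ## §1. The Legendre curve of a rational `q` at an odd pole of `j(q)` with `ord_p q` even is multiplicative over `ℚ` -/

namespace RatPointEven

/-- `|p|_v = exp(−1)` at the place `v` of `ℚ` over `p` (`v = (p)`, Mathlib `intValuation_singleton`). [folklore] -/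
theorem valuation_natGenerator (v : HeightOneSpectrum (𝓞 ℚ)) :
    v.valuation ℚ (Rat.HeightOneSpectrum.natGenerator v : ℚ) = WithZero.exp (-1 : ℤ) := by
  have hp0 : (Rat.HeightOneSpectrum.natGenerator v : 𝓞 ℚ) ≠ 0 := by
    exact_mod_cast (Rat.HeightOneSpectrum.prime_natGenerator v).ne_zero
  have hval : v.valuation ℚ (algebraMap (𝓞 ℚ) ℚ (Rat.HeightOneSpectrum.natGenerator v : 𝓞 ℚ)) =
      WithZero.exp (-1 : ℤ) := by
    rw [HeightOneSpectrum.valuation_of_algebraMap]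
    exact HeightOneSpectrum.intValuation_singleton _ hp0 (UniformABCConjecture.asIdeal_eq_span_natGenerator v)
  rw [map_natCast] at hval
  exact hval

/-- `|p^{−m}|_v = exp(m)` (integer exponent) at the place of `ℚ` over `p`. [folklore] -/
theorem valuation_natGenerator_zpow_neg (v : HeightOneSpectrum (𝓞 ℚ)) (m : ℤ) :
    v.valuation ℚ ((Rat.HeightOneSpectrum.natGenerator v : ℚ) ^ (-m)) = WithZero.exp m := by
  rw [map_zpow₀, valuation_natGenerator, ← WithZero.exp_zsmul]
  congr 1
  simp

/-- **At an ODD pole of `j(q)` where `ord_p q` is EVEN, `y² = x(x−1)(x−q)` is MULTIPLICATIVE over `ℚ`.** Let `v` be the place of `ℚ` over a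
prime `p ≠ 2`, `ord_v j(q) < 0` (a bad place of the Legendre curve) and `|q|_v = exp(2m)`, `q − 1 ≠ 0`. If `|q|_v < 1` or `|q − 1|_v < 1`
(`q ∈ ℤ_p`, `q ≡ 0, 1`) this is Silverman's Case 2 over `ℚ` (the tree's `legendre_hasMultiplicativeReductionAt_of_valuation_lt_one` /
`…_sub_one_lt_one`); `|q|_v = |q−1|_v = 1` is excluded by the pole (good reduction forces `|j|_v ≤ 1`); if `|q|_v > 1` it is Case 3 with the
RATIONAL rescaling `d = p^{−m}`, `|d|_v² = exp(2m) = |q|_v` (this seat's `legendre_hasMultiplicativeReductionAt_of_one_lt_valuation_of_valuation_sq_eq`).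
No quadratic twist is needed. [cite: SilvermanAEC2009, proof of Prop. VII.5.4(c), Cases 2–3 (PDF pp. 176–177)] [cite: Mochizuki2012, IUTchIV Prop 1.8 (vi) p.19] -/
theorem legendre_hasMultiplicativeReductionAt_of_even {q : ℚ} (v : HeightOneSpectrum (𝓞 ℚ))
    (hp2 : Rat.HeightOneSpectrum.natGenerator v ≠ 2)
    (hpole : Literature.IUT.LogVolume.ord ℚ v (Cor22.jInv q) < 0)
    {m : ℤ} (hev : v.valuation ℚ q = WithZero.exp (2 * m)) (hq1 : q - 1 ≠ 0) :
    (⟨0, -(1 + q), 0, q, 0⟩ : WeierstrassCurve ℚ).HasMultiplicativeReductionAt v := by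
  have h2 : v.valuation ℚ (2 : ℚ) = 1 := by
    have h := (UniformABCConjecture.valuation_natCast_eq_one_iff v 2).2 (fun hd => hp2
      ((Nat.prime_dvd_prime_iff_eq (Rat.HeightOneSpectrum.prime_natGenerator v) Nat.prime_two).1 hd))
    exact_mod_cast h
  have hq0 : q ≠ 0 := by
    intro h
    rw [h, Valuation.map_zero] at hev
    exact WithZero.coe_ne_zero hev.symm
  have hq1' : q ≠ 1 := fun h => hq1 (by rw [h, sub_self])
  haveI hE : (⟨0, -(1 + q), 0, q, 0⟩ : WeierstrassCurve ℚ).IsElliptic := (legendre_isElliptic_iff (by norm_num) q).mpr ⟨hq0, hq1'⟩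
  -- the pole excludes good reduction
  have hj0 : Cor22.jInv q ≠ 0 := fun h0 => by
    rw [h0, ord_zero] at hpole
    exact lt_irrefl _ hpole
  have hjgt : 1 < v.valuation ℚ (Cor22.jInv q) := (ord_neg_iff_one_lt_valuation (F := ℚ) v hj0).1 hpole
  have hnotgood : ¬ (v.valuation ℚ q = 1 ∧ v.valuation ℚ (q - 1) = 1) := by
    rintro ⟨hq, hq'⟩
    have hgood := legendre_hasGoodReductionAt_of_valuation_eq_one v h2 hq hq'
    have hjle := Literature.NumberTheory.DiophantineGeometry.GenEll.valuation_j_le_one_of_hasGoodReduction_localMinimalModel v _ hgood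
    haveI hE' : (⟨0, -(1 + (ratPoint q).x), 0, (ratPoint q).x, 0⟩ : WeierstrassCurve (ratPoint q).F).IsElliptic := hE
    have hjl : (⟨0, -(1 + q), 0, q, 0⟩ : WeierstrassCurve ℚ).j = Cor22.jInv q :=
      Cor22.j_legendre (ratPoint q) (show (ratPoint q).InU from ⟨hq0, hq1'⟩)
    rw [hjl] at hjle
    exact hjgt.not_ge hjle
  rcases lt_trichotomy (v.valuation ℚ q) 1 with hlt | heq | hgt
  · -- Case 2a: `q ≡ 0 (mod p)`
    exact legendre_hasMultiplicativeReductionAt_of_valuation_lt_one v h2 hlt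
  · -- `|q|_v = 1`: then `|q − 1|_v < 1` (Case 2b), equality being excluded by the pole
    have hle1 : v.valuation ℚ (q - 1) ≤ 1 := Valuation.map_sub_le _ heq.le (by rw [Valuation.map_one])
    rcases hle1.lt_or_eq with hlt1 | heq1
    · exact legendre_hasMultiplicativeReductionAt_of_valuation_sub_one_lt_one v h2 hlt1
    · exact absurd ⟨heq, heq1⟩ hnotgood
  · -- Case 3 over `ℚ`: `|q|_v = exp(2m) > 1`, `d = p^{−m}`
    exact legendre_hasMultiplicativeReductionAt_of_one_lt_valuation_of_valuation_sq_eq v h2 hgt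
      (d := (Rat.HeightOneSpectrum.natGenerator v : ℚ) ^ (-m))
      (by rw [valuation_natGenerator_zpow_neg, hev, ← WithZero.exp_nsmul, two_mul, two_nsmul])

end RatPointEven

/-! ## §2. The fibre form: `e(K_{x₀}/ℚ_p) ∣ 15·l` at a rational pole with `ord_p q`, `ord_p(q−1)` even -/

/-- **THE «PARITY» LOCAL TYPE at a fibre point over a rational pole of `j`, away from `2·3·5·l`.** For a genuine Θ-volume datum `T` at
`(ratPoint q, l)`, a prime `p ∉ {2, 3, 5, l}` such that, at the place `v` of `ℚ` over `p`, `ord_v j(q) < 0` and BOTH `|q|_v`, `|q − 1|_v` are EVEN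
powers `exp(2m)`, `exp(2m′)`, and EVERY point `x₀` of the fibre over `p` of the index of the `K`-level pilot datum `pilotDataOfK T.D T.K`:
**`e(K_{x₀}/ℚ_p) ∣ 15·l` and `p ∤ e(K_{x₀}/ℚ_p)`** (`e(x₀|v₁) ∣ l` in `K/F`; `e(v₁|p) ∣ 15` in `F/ℚ` because `E_q` is multiplicative at `p` over `ℚ`
(§1) and inertia fixes `√−1, √q, √(q−1)` — this seat's `Cor22.ThetaVolumeDatumAt.ramificationIdx_int_dvd_fifteen_mul_ratPoint'`, p463720).
Compare abc-iut-W-neg-1's `GenuineK.absRamificationIdx_kOf_dvd_ratPoint` (`∣ 60·l`, no parity hypothesis).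
[cite: Mochizuki2012, IUTchI Ex. 3.2 (iv) p. 71; IUTchIV Thm. 1.10 proof Steps (ii)–(iii) p. 24–26] [cite: SilvermanATAEC1994, V.4–V.5 and Exercise 5.13 (b)]
[claim: Mochizuki2012, status: disputed] -/
theorem GenuineK.absRamificationIdx_kOf_dvd_fifteen_mul_ratPoint {q : ℚ} {l : ℕ} (T : Cor22.ThetaVolumeDatumAt (ratPoint q) l)
    (pp : Nat.Primes) (hp2 : (pp : ℕ) ≠ 2) (hp3 : (pp : ℕ) ≠ 3) (hp5 : (pp : ℕ) ≠ 5) (hpl : (pp : ℕ) ≠ l)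
    (hpole : ∀ v : HeightOneSpectrum (𝓞 ℚ), Rat.HeightOneSpectrum.natGenerator v = pp →
      Literature.IUT.LogVolume.ord ℚ v (Cor22.jInv q) < 0)
    (hev : ∀ v : HeightOneSpectrum (𝓞 ℚ), Rat.HeightOneSpectrum.natGenerator v = pp →
      ∃ m : ℤ, v.valuation ℚ q = WithZero.exp (2 * m))
    (hev1 : ∀ v : HeightOneSpectrum (𝓞 ℚ), Rat.HeightOneSpectrum.natGenerator v = pp →
      ∃ m : ℤ, v.valuation ℚ (q - 1) = WithZero.exp (2 * m)) :
    letI := T.instFieldF; letI := T.instNumberFieldF; letI := T.instAlgebraF; letI := T.instFieldK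
    letI := T.instNumberFieldK; letI := T.instAlgebraK; letI := T.instFieldFbar; letI := T.instAlgebraFbar
    letI := T.instAlgebraKFbar; letI := T.instIsElliptic
    haveI : Fact (pp : ℕ).Prime := ⟨pp.2⟩
    ∀ x₀ : (thetaIndex (pilotDataOfK T.D T.K)).Fibre (.inr pp),
      absRamificationIdx (pp : ℕ) (kOf (pilotDataOfK T.D T.K) pp.1 x₀) ∣ 15 * l ∧
      ¬ (pp : ℕ) ∣ absRamificationIdx (pp : ℕ) (kOf (pilotDataOfK T.D T.K) pp.1 x₀) := by
  -- adapted from abc-iut-W-neg-1's `GenuineK.absRamificationIdx_kOf_dvd_ratPoint` (Cor312GenuineKLocalType.lean)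
  letI := T.instFieldF; letI := T.instNumberFieldF; letI := T.instAlgebraF; letI := T.instFieldK
  letI := T.instNumberFieldK; letI := T.instAlgebraK; letI := T.instFieldFbar; letI := T.instAlgebraFbar
  letI := T.instAlgebraKFbar; letI := T.instIsElliptic
  haveI : Fact (pp : ℕ).Prime := ⟨pp.2⟩
  set X := pilotDataOfK T.D T.K with hXdef
  intro x₀
  set w := placeOf X pp.1 x₀ with hwdef
  have hpw : ((pp : ℕ) : 𝓞 T.K) ∈ w.asIdeal := natCast_mem_placeOf X pp.1 x₀
  have hwchar : residueChar T.K w = (pp : ℕ) := residueChar_eq_of_natCast_mem pp.1 hpw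
  -- the norm-defined `e(K_{x₀}/ℚ_p)` is `e(w | p)`
  have hekOf : absRamificationIdx (pp : ℕ) (kOf X pp.1 x₀) = w.asIdeal.ramificationIdx ℤ := by
    rw [show absRamificationIdx (pp : ℕ) (kOf X pp.1 x₀) =
        absRamificationIdx (pp : ℕ) (RescaledCompletion T.K pp.1 (placeOf X pp.1 x₀) hpw) from rfl,
      absRamificationIdx_rescaledCompletion]
  have hnot : (pp : ℕ) ∉ ({2, 3, 5, l} : Finset ℕ) := by
    simp only [Finset.mem_insert, Finset.mem_singleton, not_or]
    exact ⟨hp2, hp3, hp5, hpl⟩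
  -- `q − 1 ≠ 0` (its valuation at the place over `p` is an `exp`)
  have hq1 : q - 1 ≠ 0 := by
    obtain ⟨v, hv⟩ : ∃ v : HeightOneSpectrum (𝓞 ℚ), Rat.HeightOneSpectrum.natGenerator v = pp :=
      ⟨(Rat.HeightOneSpectrum.primesEquiv (R := 𝓞 ℚ)).symm pp,
        congrArg Subtype.val ((Rat.HeightOneSpectrum.primesEquiv (R := 𝓞 ℚ)).apply_symm_apply pp)⟩
    obtain ⟨m, hm⟩ := hev1 v hv
    intro h
    rw [h, Valuation.map_zero] at hm
    exact WithZero.coe_ne_zero hm.symm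
  have hdvd : w.asIdeal.ramificationIdx ℤ ∣ 15 * l :=
    T.ramificationIdx_int_dvd_fifteen_mul_ratPoint' hnot
      (fun v hv => by
        obtain ⟨m, hm⟩ := hev v hv
        exact RatPointEven.legendre_hasMultiplicativeReductionAt_of_even v (by rw [hv]; exact hp2) (hpole v hv) hm hq1)
      hev hev1 w hwchar
  rw [hekOf]
  refine ⟨hdvd, fun h => ?_⟩
  -- `p ∤ 15·l` for a prime `p ∉ {2, 3, 5, l}`
  have h' : (pp : ℕ) ∣ 15 * l := h.trans hdvd
  have hl : l.Prime := T.D.l_prime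
  rcases (Nat.Prime.dvd_mul pp.2).1 h' with h15 | hll
  · have h15' : (pp : ℕ) ∣ 3 * 5 := by norm_num; exact h15
    rcases (Nat.Prime.dvd_mul pp.2).1 h15' with h3' | h5'
    · exact hp3 ((Nat.prime_dvd_prime_iff_eq pp.2 Nat.prime_three).1 h3')
    · exact hp5 ((Nat.prime_dvd_prime_iff_eq pp.2 Nat.prime_five).1 h5')
  · exact hpl ((Nat.prime_dvd_prime_iff_eq pp.2 hl).1 hll)

/-- **Corollary: `e(K_{x₀}/ℚ_p) ≤ 15·l`** at every fibre point `x₀ | p` of a genuine Θ-volume datum at `(ratPoint q, l)` under the hypotheses of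
`GenuineK.absRamificationIdx_kOf_dvd_fifteen_mul_ratPoint` — the lattice-tameness input `e ≤ p − 2` of the exact tame decider
(abc-iut-w5-d180 `…_of_tame_orders_upper`, abc-iut-w5-d107 `…_of_tame_robust`) whenever `15·l + 2 ≤ p`.
[cite: Mochizuki2012, IUTchIV Prop. 1.2 p. 10] [claim: Mochizuki2012, status: disputed] -/
theorem GenuineK.absRamificationIdx_kOf_le_fifteen_mul_ratPoint {q : ℚ} {l : ℕ} (T : Cor22.ThetaVolumeDatumAt (ratPoint q) l)
    (pp : Nat.Primes) (hp2 : (pp : ℕ) ≠ 2) (hp3 : (pp : ℕ) ≠ 3) (hp5 : (pp : ℕ) ≠ 5) (hpl : (pp : ℕ) ≠ l)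
    (hpole : ∀ v : HeightOneSpectrum (𝓞 ℚ), Rat.HeightOneSpectrum.natGenerator v = pp →
      Literature.IUT.LogVolume.ord ℚ v (Cor22.jInv q) < 0)
    (hev : ∀ v : HeightOneSpectrum (𝓞 ℚ), Rat.HeightOneSpectrum.natGenerator v = pp →
      ∃ m : ℤ, v.valuation ℚ q = WithZero.exp (2 * m))
    (hev1 : ∀ v : HeightOneSpectrum (𝓞 ℚ), Rat.HeightOneSpectrum.natGenerator v = pp →
      ∃ m : ℤ, v.valuation ℚ (q - 1) = WithZero.exp (2 * m)) :
    letI := T.instFieldF; letI := T.instNumberFieldF; letI := T.instAlgebraF; letI := T.instFieldK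
    letI := T.instNumberFieldK; letI := T.instAlgebraK; letI := T.instFieldFbar; letI := T.instAlgebraFbar
    letI := T.instAlgebraKFbar; letI := T.instIsElliptic
    haveI : Fact (pp : ℕ).Prime := ⟨pp.2⟩
    ∀ x₀ : (thetaIndex (pilotDataOfK T.D T.K)).Fibre (.inr pp),
      absRamificationIdx (pp : ℕ) (kOf (pilotDataOfK T.D T.K) pp.1 x₀) ≤ 15 * l := by
  letI := T.instFieldF; letI := T.instNumberFieldF; letI := T.instAlgebraF; letI := T.instFieldK
  letI := T.instNumberFieldK; letI := T.instAlgebraK; letI := T.instFieldFbar; letI := T.instAlgebraFbar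
  letI := T.instAlgebraKFbar; letI := T.instIsElliptic
  intro x₀
  have hl : l.Prime := T.D.l_prime
  exact Nat.le_of_dvd (by have := hl.pos; omega)
    (GenuineK.absRamificationIdx_kOf_dvd_fifteen_mul_ratPoint T pp hp2 hp3 hp5 hpl hpole hev hev1 x₀).1

end Summit.ABC.IUTFork.Conditional

end
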